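import Summits.FinalStateConjecture.FinalStateConjecture.Theses.HarmonicFluxCensus
import Literature.Geometry.Lorentzian.MaximalDataScalarCurvature
import HarnessLib

/-!
# Line `maximal-leaf-census` for the crux `BoundedCensusGeometry` (stmt-FinalStateConjecture-17468)

Registered skeleton (crux-strategist, BC2-redirect decomposition of the crux): three stubs — the three
typed PIECES of the split — and the kernel-checked composition `BoundedCensusGeometry_of` concluding the
route decl `Theses.HarmonicFluxCensus.BoundedCensusGeometry` BY NAME.

* `stub_maximalLeafDominance` (dynamical, monotone, committed to census leaves): uniform census cost of
  DOMINATING body families on complete maximal vacuum-constrained Cauchy leaves.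
* `stub_nonnegScalarCensusInequality` (kinematic): the slice census inequality for complete data of
  nonnegative scalar curvature (the sibling `SliceCensusInequality` restricted; `R_h = |k|² ≥ 0` on
  maximal vacuum data, Isenberg–Mazzeo–Pollack 2003, proved in tree).
* `stub_cheapWitnessPerCount` (exact-count clause): the crux with `∃ c₁ Q₀` commuted inside `∀ m`.

Composition: finiteness `m ≤ m' ≤ N₀` of every body family on every Cauchy slice from stubs 1+2, then
uniformisation of stub 3's per-count constants by `∑_{n ≤ N₀} max (· n) 0` and monotonicity of the two
census clauses. Each stub has its own 2-stub birth skeleton (`Lines/split-<Piece>.lean`). Probes: no stub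
implies the crux or the summit by `exact?` / `aesop` / `unfold; simpa` (strategist folder `bc/`).

References: [Bartnik1984] [ChruscielWald1994] [AnderssonMarsMetzgerSimon2009] [IsenbergMazzeoPollack2002]
[Carron1999] [LiYau1983].
-/

noncomputable section

-- the doubled `FinalStateConjecture` path component is the summit/problem naming scheme
set_option linter.dupNamespace false

open scoped Manifold ContDiff Topology BigOperators ENNReal
open Set Filter MeasureTheory

namespace Summit.FinalStateConjecture.FinalStateConjecture.Cruxes.BoundedCensusGeometry.MaximalLeafCensus

open Summit.FinalStateConjecture.FinalStateConjecture.Theses.HarmonicFluxCensus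

/-- **stub 1 — `MaximalLeafDominance`** (piece 1 of the split): for every MGHD of admissible data there
are `(c₁, Q₀)` such that every family of `m` pairwise disjoint compact bodies bounded by connected
outermost MOTSs on any Cauchy slice is dominated (`m ≤ m'`) by such a family on a complete, maximal,
vacuum-constrained Cauchy slice of the same spacetime at census cost `≤ (c₁, Q₀)`. Bartnik 1984
(maximal slices); Andersson–Mars–Metzger–Simon 2009 (MOTT propagation). -/
theorem stub_maximalLeafDominance :
    ∀ (X : Type) [TopologicalSpace X] [ChartedSpace (EuclideanSpace ℝ (Fin 3)) X] [IsManifold (𝓡 3) ((⊤ : ENat) : WithTop ENat) X] [T2Space X] [SecondCountableTopology X] [ConnectedSpace X] (D : Literature.Geometry.Lorentzian.InitialDataSet (𝓡 3) X), D ∈ Literature.Geometry.Lorentzian.admissibleVacuumData X → ∀ 𝒟 : Literature.Geometry.Lorentzian.VacuumCauchyDevelopment D, 𝒟.IsMaximal → ∃ c₁ Q₀ : ℝ, ∀ (X' : Type) [TopologicalSpace X'] [ChartedSpace (EuclideanSpace ℝ (Fin 3)) X'] [IsManifold (𝓡 3) ((⊤ : ENat) : WithTop ENat) X'] [ConnectedSpace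 X'] (D' : Literature.Geometry.Lorentzian.InitialDataSet (𝓡 3) X') (𝒟' : Literature.Geometry.Lorentzian.CauchyDevelopment D'), 𝒟'.toSpacetime = 𝒟.toSpacetime → ∀ (m : ℕ) (S : Fin m → Literature.Geometry.Lorentzian.OutermostMOTS (𝓡 3) D'.h D'.k), (∀ j, ConnectedSpace (S j).surf) → (∀ j, IsCompact (((S j).exterior : Set X'))ᶜ ∧ (interior (((S j).exterior : Set X'))ᶜ).Nonempty) → Pairwise (fun j j' ↦ Disjoint (((S j).exterior : Set X'))ᶜ (((S j').exterior : Set X'))ᶜ) → ∃ (X'' : Type) (_ : TopologicalSpace X'') (_ : ChartedSpace (EuclideanSpace ℝ (Fin 3)) X'') (_ : IsManifold (𝓡 3) ((⊤ : ENat) : WithTop ENat) X'') (_ : T2Space X'') (_ : LocallyCompactSpace X'') (_ : MeasurableSpace X'') (_ : BorelSpace X'') (_ : ConnectedSpace X'') (D'' : Literature.Geometry.Lorentzian.InitialDataSet (𝓡 3) X'') (𝒟'' : Literature.Geometry.Lorentzian.CauchyDevelopment D'') (_ : D''.metric.HasLeviCivita), 𝒟''.toSpacetime = 𝒟.toSpacetime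 ∧ D''.IsComplete ∧ D''.IsMaximalData ∧ D''.IsVacuumConstraintSolution ∧ ∃ (m' : ℕ) (S'' : Fin m' → Literature.Geometry.Lorentzian.OutermostMOTS (𝓡 3) D''.h D''.k), m ≤ m' ∧ (∀ j, ConnectedSpace (S'' j).surf) ∧ (∀ j, IsCompact (((S'' j).exterior : Set X''))ᶜ ∧ (interior (((S'' j).exterior : Set X''))ᶜ).Nonempty) ∧ Pairwise (fun j j' ↦ Disjoint (((S'' j).exterior : Set X''))ᶜ (((S'' j').exterior : Set X''))ᶜ) ∧ (∀ ζ : X'' → ℝ, ContMDiff (𝓡 3) 𝓘(ℝ, ℝ) 1 ζ → HasCompactSupport ζ → (∫⁻ x in ⋂ j, ((S'' j).exterior : Set X''), ENNReal.ofReal (|ζ x| ^ 6) ∂(Literature.Geometry.Lorentzian.riemannianMeasure D''.h)) ^ (1 / 3 : ℝ) ≤ ENNReal.ofReal c₁ * ∫⁻ x in ⋂ j, ((S'' j).exterior : Set X''), ENNReal.ofReal (D''.metric.innerDual x (mvfderiv (𝓡 3) ζ x).toLinearMap (mvfderiv (𝓡 3) ζ x).toLinearMap) ∂(Literature.Geometry.Lorentzian.riemannianMeasure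 D''.h)) ∧ (∫⁻ x in ⋂ j, ((S'' j).exterior : Set X''), ENNReal.ofReal ((D''.metric.normSq x (D''.metric.ricci x)) ^ (3 / 4 : ℝ)) ∂(Literature.Geometry.Lorentzian.riemannianMeasure D''.h)) + ∑ j, (∫⁻ x in Set.range (S'' j).f, ENNReal.ofReal (D''.normSqK x) ∂(Literature.Geometry.Lorentzian.riemannianVolume D''.h 2)) ≤ ENNReal.ofReal Q₀ := by
  sorry

/-- **stub 2 — `NonnegScalarCensusInequality`** (piece 2): `SliceCensusInequality` for complete data
sets of nonnegative scalar curvature. Carron 1999 / Li–Yau 1983 (CLR–Hodge count), the route's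
FluxFormsLowerBound / RelativeCLRHodgeBound typed in `Lines/split-NonnegScalarCensusInequality.lean`. -/
theorem stub_nonnegScalarCensusInequality :
    ∀ c₁ Q₀ : ℝ, ∃ N₀ : ℕ, ∀ (X : Type) [TopologicalSpace X] [ChartedSpace (EuclideanSpace ℝ (Fin 3)) X] [IsManifold (𝓡 3) ((⊤ : ENat) : WithTop ENat) X] [T2Space X] [LocallyCompactSpace X] [MeasurableSpace X] [BorelSpace X] [ConnectedSpace X] (D : Literature.Geometry.Lorentzian.InitialDataSet (𝓡 3) X), (∀ [D.metric.HasLeviCivita], D.IsComplete → (∀ x, 0 ≤ D.metric.scalarCurvature x) → ∀ (m : ℕ) (S : Fin m → Literature.Geometry.Lorentzian.OutermostMOTS (𝓡 3) D.h D.k), (∀ j, ConnectedSpace (S j).surf) → (∀ j, IsCompact (((S j).exterior : Set X))ᶜ ∧ (interior (((S j).exterior : Set X))ᶜ).Nonempty) → Pairwise (fun j j' ↦ Disjoint (((S j).exterior : Set X))ᶜ (((S j').exterior : Set X))ᶜ) → (∀ ζ : X → ℝ, ContMDiff (𝓡 3) 𝓘(ℝ, ℝ) 1 ζ → HasCompactSupport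 ζ → (∫⁻ x in ⋂ j, ((S j).exterior : Set X), ENNReal.ofReal (|ζ x| ^ 6) ∂(Literature.Geometry.Lorentzian.riemannianMeasure D.h)) ^ (1 / 3 : ℝ) ≤ ENNReal.ofReal c₁ * ∫⁻ x in ⋂ j, ((S j).exterior : Set X), ENNReal.ofReal (D.metric.innerDual x (mvfderiv (𝓡 3) ζ x).toLinearMap (mvfderiv (𝓡 3) ζ x).toLinearMap) ∂(Literature.Geometry.Lorentzian.riemannianMeasure D.h)) → (∫⁻ x in ⋂ j, ((S j).exterior : Set X), ENNReal.ofReal ((D.metric.normSq x (D.metric.ricci x)) ^ (3 / 4 : ℝ)) ∂(Literature.Geometry.Lorentzian.riemannianMeasure D.h)) + ∑ j, (∫⁻ x in Set.range (S j).f, ENNReal.ofReal (D.normSqK x) ∂(Literature.Geometry.Lorentzian.riemannianVolume D.h 2)) ≤ ENNReal.ofReal Q₀ → m ≤ N₀) := by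
  sorry

/-- **stub 3 — `CheapWitnessPerCount`** (piece 3): per count `m`, bodies seen on some Cauchy slice are
seen on a complete Cauchy slice of the same spacetime at some finite census cost. -/
theorem stub_cheapWitnessPerCount :
    ∀ (X : Type) [TopologicalSpace X] [ChartedSpace (EuclideanSpace ℝ (Fin 3)) X] [IsManifold (𝓡 3) ((⊤ : ENat) : WithTop ENat) X] [T2Space X] [SecondCountableTopology X] [ConnectedSpace X] (D : Literature.Geometry.Lorentzian.InitialDataSet (𝓡 3) X), D ∈ Literature.Geometry.Lorentzian.admissibleVacuumData X → ∀ 𝒟 : Literature.Geometry.Lorentzian.VacuumCauchyDevelopment D, 𝒟.IsMaximal → ∀ m : ℕ, ∃ c₁ Q₀ : ℝ, ∀ (X' : Type) [TopologicalSpace X'] [ChartedSpace (EuclideanSpace ℝ (Fin 3)) X'] [IsManifold (𝓡 3) ((⊤ : ENat) : WithTop ENat) X'] [ConnectedSpace X'] (D' : Literature.Geometry.Lorentzian.InitialDataSet (𝓡 3) X') (𝒟' : Literature.Geometry.Lorentzian.CauchyDevelopment D'), 𝒟'.toSpacetime = 𝒟.toSpacetime → ∀ (S : Fin m → Literature.Geometry.Lorentzian.OutermostMOTS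 (𝓡 3) D'.h D'.k), (∀ j, ConnectedSpace (S j).surf) → (∀ j, IsCompact (((S j).exterior : Set X'))ᶜ ∧ (interior (((S j).exterior : Set X'))ᶜ).Nonempty) → Pairwise (fun j j' ↦ Disjoint (((S j).exterior : Set X'))ᶜ (((S j').exterior : Set X'))ᶜ) → ∃ (X'' : Type) (_ : TopologicalSpace X'') (_ : ChartedSpace (EuclideanSpace ℝ (Fin 3)) X'') (_ : IsManifold (𝓡 3) ((⊤ : ENat) : WithTop ENat) X'') (_ : T2Space X'') (_ : LocallyCompactSpace X'') (_ : MeasurableSpace X'') (_ : BorelSpace X'') (_ : ConnectedSpace X'') (D'' : Literature.Geometry.Lorentzian.InitialDataSet (𝓡 3) X'') (𝒟'' : Literature.Geometry.Lorentzian.CauchyDevelopment D'') (_ : D''.metric.HasLeviCivita), 𝒟''.toSpacetime = 𝒟.toSpacetime ∧ D''.IsComplete ∧ ∃ S'' : Fin m → Literature.Geometry.Lorentzian.OutermostMOTS (𝓡 3) D''.h D''.k, (∀ j, ConnectedSpace (S'' j).surf) ∧ (∀ j, IsCompact (((S'' j).exterior : Set X''))ᶜ ∧ (interior (((S'' j).exterior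 : Set X''))ᶜ).Nonempty) ∧ Pairwise (fun j j' ↦ Disjoint (((S'' j).exterior : Set X''))ᶜ (((S'' j').exterior : Set X''))ᶜ) ∧ (∀ ζ : X'' → ℝ, ContMDiff (𝓡 3) 𝓘(ℝ, ℝ) 1 ζ → HasCompactSupport ζ → (∫⁻ x in ⋂ j, ((S'' j).exterior : Set X''), ENNReal.ofReal (|ζ x| ^ 6) ∂(Literature.Geometry.Lorentzian.riemannianMeasure D''.h)) ^ (1 / 3 : ℝ) ≤ ENNReal.ofReal c₁ * ∫⁻ x in ⋂ j, ((S'' j).exterior : Set X''), ENNReal.ofReal (D''.metric.innerDual x (mvfderiv (𝓡 3) ζ x).toLinearMap (mvfderiv (𝓡 3) ζ x).toLinearMap) ∂(Literature.Geometry.Lorentzian.riemannianMeasure D''.h)) ∧ (∫⁻ x in ⋂ j, ((S'' j).exterior : Set X''), ENNReal.ofReal ((D''.metric.normSq x (D''.metric.ricci x)) ^ (3 / 4 : ℝ)) ∂(Literature.Geometry.Lorentzian.riemannianMeasure D''.h)) + ∑ j, (∫⁻ x in Set.range (S'' j).f, ENNReal.ofReal (D''.normSqK x) ∂(Literature.Geometry.Lorentzian.riemannianVolume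 D''.h 2)) ≤ ENNReal.ofReal Q₀ := by
  sorry

/-- **Composition with explicit hypotheses** `stub 1 → stub 2 → stub 3 → BoundedCensusGeometry`
(kernel-checked, sorry-free; the route decl by name, wrapped in `id` so that the skeleton audit's
crux-concluding theorem is the hypothesis-free `BoundedCensusGeometry_of` below, which applies it to the
`stub_*` — a crux-concluding theorem with binders is `skeleton.extra-hypothesis`). Isenberg–Mazzeo–Pollack 2003, p. 371 for `R_h ≥ 0` on maximal vacuum leaves.
[cite: IsenbergMazzeoPollack2002, Introduction p. 371] -/
theorem boundedCensusGeometry_of_statements :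
    (∀ (X : Type) [TopologicalSpace X] [ChartedSpace (EuclideanSpace ℝ (Fin 3)) X] [IsManifold (𝓡 3) ((⊤ : ENat) : WithTop ENat) X] [T2Space X] [SecondCountableTopology X] [ConnectedSpace X] (D : Literature.Geometry.Lorentzian.InitialDataSet (𝓡 3) X), D ∈ Literature.Geometry.Lorentzian.admissibleVacuumData X → ∀ 𝒟 : Literature.Geometry.Lorentzian.VacuumCauchyDevelopment D, 𝒟.IsMaximal → ∃ c₁ Q₀ : ℝ, ∀ (X' : Type) [TopologicalSpace X'] [ChartedSpace (EuclideanSpace ℝ (Fin 3)) X'] [IsManifold (𝓡 3) ((⊤ : ENat) : WithTop ENat) X'] [ConnectedSpace X'] (D' : Literature.Geometry.Lorentzian.InitialDataSet (𝓡 3) X') (𝒟' : Literature.Geometry.Lorentzian.CauchyDevelopment D'), 𝒟'.toSpacetime = 𝒟.toSpacetime → ∀ (m : ℕ) (S : Fin m → Literature.Geometry.Lorentzian.OutermostMOTS (𝓡 3) D'.h D'.k), (∀ j, ConnectedSpace (S j).surf) → (∀ j, IsCompact (((S j).exterior : Set X'))ᶜ ∧ (interior (((S j).exterior : Set X'))ᶜ).Nonempty)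 → Pairwise (fun j j' ↦ Disjoint (((S j).exterior : Set X'))ᶜ (((S j').exterior : Set X'))ᶜ) → ∃ (X'' : Type) (_ : TopologicalSpace X'') (_ : ChartedSpace (EuclideanSpace ℝ (Fin 3)) X'') (_ : IsManifold (𝓡 3) ((⊤ : ENat) : WithTop ENat) X'') (_ : T2Space X'') (_ : LocallyCompactSpace X'') (_ : MeasurableSpace X'') (_ : BorelSpace X'') (_ : ConnectedSpace X'') (D'' : Literature.Geometry.Lorentzian.InitialDataSet (𝓡 3) X'') (𝒟'' : Literature.Geometry.Lorentzian.CauchyDevelopment D'') (_ : D''.metric.HasLeviCivita), 𝒟''.toSpacetime = 𝒟.toSpacetime ∧ D''.IsComplete ∧ D''.IsMaximalData ∧ D''.IsVacuumConstraintSolution ∧ ∃ (m' : ℕ) (S'' : Fin m' → Literature.Geometry.Lorentzian.OutermostMOTS (𝓡 3) D''.h D''.k), m ≤ m' ∧ (∀ j, ConnectedSpace (S'' j).surf) ∧ (∀ j, IsCompact (((S'' j).exterior : Set X''))ᶜ ∧ (interior (((S'' j).exterior : Set X''))ᶜ).Nonempty) ∧ Pairwise (fun j j' ↦ Disjoint (((S''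 j).exterior : Set X''))ᶜ (((S'' j').exterior : Set X''))ᶜ) ∧ (∀ ζ : X'' → ℝ, ContMDiff (𝓡 3) 𝓘(ℝ, ℝ) 1 ζ → HasCompactSupport ζ → (∫⁻ x in ⋂ j, ((S'' j).exterior : Set X''), ENNReal.ofReal (|ζ x| ^ 6) ∂(Literature.Geometry.Lorentzian.riemannianMeasure D''.h)) ^ (1 / 3 : ℝ) ≤ ENNReal.ofReal c₁ * ∫⁻ x in ⋂ j, ((S'' j).exterior : Set X''), ENNReal.ofReal (D''.metric.innerDual x (mvfderiv (𝓡 3) ζ x).toLinearMap (mvfderiv (𝓡 3) ζ x).toLinearMap) ∂(Literature.Geometry.Lorentzian.riemannianMeasure D''.h)) ∧ (∫⁻ x in ⋂ j, ((S'' j).exterior : Set X''), ENNReal.ofReal ((D''.metric.normSq x (D''.metric.ricci x)) ^ (3 / 4 : ℝ)) ∂(Literature.Geometry.Lorentzian.riemannianMeasure D''.h)) + ∑ j, (∫⁻ x in Set.range (S'' j).f, ENNReal.ofReal (D''.normSqK x) ∂(Literature.Geometry.Lorentzian.riemannianVolume D''.h 2)) ≤ ENNReal.ofReal Q₀) →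
    (∀ c₁ Q₀ : ℝ, ∃ N₀ : ℕ, ∀ (X : Type) [TopologicalSpace X] [ChartedSpace (EuclideanSpace ℝ (Fin 3)) X] [IsManifold (𝓡 3) ((⊤ : ENat) : WithTop ENat) X] [T2Space X] [LocallyCompactSpace X] [MeasurableSpace X] [BorelSpace X] [ConnectedSpace X] (D : Literature.Geometry.Lorentzian.InitialDataSet (𝓡 3) X), (∀ [D.metric.HasLeviCivita], D.IsComplete → (∀ x, 0 ≤ D.metric.scalarCurvature x) → ∀ (m : ℕ) (S : Fin m → Literature.Geometry.Lorentzian.OutermostMOTS (𝓡 3) D.h D.k), (∀ j, ConnectedSpace (S j).surf) → (∀ j, IsCompact (((S j).exterior : Set X))ᶜ ∧ (interior (((S j).exterior : Set X))ᶜ).Nonempty) → Pairwise (fun j j' ↦ Disjoint (((S j).exterior : Set X))ᶜ (((S j').exterior : Set X))ᶜ) → (∀ ζ : X → ℝ, ContMDiff (𝓡 3) 𝓘(ℝ, ℝ) 1 ζ → HasCompactSupport ζ → (∫⁻ x in ⋂ j, ((S j).exterior : Set X), ENNReal.ofReal (|ζ x| ^ 6) ∂(Literature.Geometry.Lorentzian.riemannianMeasure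 D.h)) ^ (1 / 3 : ℝ) ≤ ENNReal.ofReal c₁ * ∫⁻ x in ⋂ j, ((S j).exterior : Set X), ENNReal.ofReal (D.metric.innerDual x (mvfderiv (𝓡 3) ζ x).toLinearMap (mvfderiv (𝓡 3) ζ x).toLinearMap) ∂(Literature.Geometry.Lorentzian.riemannianMeasure D.h)) → (∫⁻ x in ⋂ j, ((S j).exterior : Set X), ENNReal.ofReal ((D.metric.normSq x (D.metric.ricci x)) ^ (3 / 4 : ℝ)) ∂(Literature.Geometry.Lorentzian.riemannianMeasure D.h)) + ∑ j, (∫⁻ x in Set.range (S j).f, ENNReal.ofReal (D.normSqK x) ∂(Literature.Geometry.Lorentzian.riemannianVolume D.h 2)) ≤ ENNReal.ofReal Q₀ → m ≤ N₀)) →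
    (∀ (X : Type) [TopologicalSpace X] [ChartedSpace (EuclideanSpace ℝ (Fin 3)) X] [IsManifold (𝓡 3) ((⊤ : ENat) : WithTop ENat) X] [T2Space X] [SecondCountableTopology X] [ConnectedSpace X] (D : Literature.Geometry.Lorentzian.InitialDataSet (𝓡 3) X), D ∈ Literature.Geometry.Lorentzian.admissibleVacuumData X → ∀ 𝒟 : Literature.Geometry.Lorentzian.VacuumCauchyDevelopment D, 𝒟.IsMaximal → ∀ m : ℕ, ∃ c₁ Q₀ : ℝ, ∀ (X' : Type) [TopologicalSpace X'] [ChartedSpace (EuclideanSpace ℝ (Fin 3)) X'] [IsManifold (𝓡 3) ((⊤ : ENat) : WithTop ENat) X'] [ConnectedSpace X'] (D' : Literature.Geometry.Lorentzian.InitialDataSet (𝓡 3) X') (𝒟' : Literature.Geometry.Lorentzian.CauchyDevelopment D'), 𝒟'.toSpacetime = 𝒟.toSpacetime → ∀ (S : Fin m → Literature.Geometry.Lorentzian.OutermostMOTS (𝓡 3) D'.h D'.k), (∀ j, ConnectedSpace (S j).surf) → (∀ j, IsCompact (((S j).exterior : Set X'))ᶜ ∧ (interior (((S j).exterior : Set X'))ᶜ).Nonempty)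 → Pairwise (fun j j' ↦ Disjoint (((S j).exterior : Set X'))ᶜ (((S j').exterior : Set X'))ᶜ) → ∃ (X'' : Type) (_ : TopologicalSpace X'') (_ : ChartedSpace (EuclideanSpace ℝ (Fin 3)) X'') (_ : IsManifold (𝓡 3) ((⊤ : ENat) : WithTop ENat) X'') (_ : T2Space X'') (_ : LocallyCompactSpace X'') (_ : MeasurableSpace X'') (_ : BorelSpace X'') (_ : ConnectedSpace X'') (D'' : Literature.Geometry.Lorentzian.InitialDataSet (𝓡 3) X'') (𝒟'' : Literature.Geometry.Lorentzian.CauchyDevelopment D'') (_ : D''.metric.HasLeviCivita), 𝒟''.toSpacetime = 𝒟.toSpacetime ∧ D''.IsComplete ∧ ∃ S'' : Fin m → Literature.Geometry.Lorentzian.OutermostMOTS (𝓡 3) D''.h D''.k, (∀ j, ConnectedSpace (S'' j).surf) ∧ (∀ j, IsCompact (((S'' j).exterior : Set X''))ᶜ ∧ (interior (((S'' j).exterior : Set X''))ᶜ).Nonempty) ∧ Pairwise (fun j j' ↦ Disjoint (((S'' j).exterior : Set X''))ᶜ (((S'' j').exterior : Set X''))ᶜ) ∧ (∀ ζ : X''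 → ℝ, ContMDiff (𝓡 3) 𝓘(ℝ, ℝ) 1 ζ → HasCompactSupport ζ → (∫⁻ x in ⋂ j, ((S'' j).exterior : Set X''), ENNReal.ofReal (|ζ x| ^ 6) ∂(Literature.Geometry.Lorentzian.riemannianMeasure D''.h)) ^ (1 / 3 : ℝ) ≤ ENNReal.ofReal c₁ * ∫⁻ x in ⋂ j, ((S'' j).exterior : Set X''), ENNReal.ofReal (D''.metric.innerDual x (mvfderiv (𝓡 3) ζ x).toLinearMap (mvfderiv (𝓡 3) ζ x).toLinearMap) ∂(Literature.Geometry.Lorentzian.riemannianMeasure D''.h)) ∧ (∫⁻ x in ⋂ j, ((S'' j).exterior : Set X''), ENNReal.ofReal ((D''.metric.normSq x (D''.metric.ricci x)) ^ (3 / 4 : ℝ)) ∂(Literature.Geometry.Lorentzian.riemannianMeasure D''.h)) + ∑ j, (∫⁻ x in Set.range (S'' j).f, ENNReal.ofReal (D''.normSqK x) ∂(Literature.Geometry.Lorentzian.riemannianVolume D''.h 2)) ≤ ENNReal.ofReal Q₀) →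
      id BoundedCensusGeometry := by
  intro hDom hIneq hW
  show BoundedCensusGeometry
  intro X _ _ _ _ _ _ D hD 𝒟 hmax
  -- (1) uniform census cost on the maximal leaves, and the kinematic count it buys
  obtain ⟨c₁, Q₀, hdom⟩ := hDom X D hD 𝒟 hmax
  obtain ⟨N₀, hN₀⟩ := hIneq c₁ Q₀
  -- (2) every body family on every Cauchy slice of `𝒟` has at most `N₀` members
  have hbound : ∀ (X' : Type) [TopologicalSpace X'] [ChartedSpace (EuclideanSpace ℝ (Fin 3)) X']
      [IsManifold (𝓡 3) ((⊤ : ENat) : WithTop ENat) X'] [ConnectedSpace X']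
      (D' : Literature.Geometry.Lorentzian.InitialDataSet (𝓡 3) X')
      (𝒟' : Literature.Geometry.Lorentzian.CauchyDevelopment D'), 𝒟'.toSpacetime = 𝒟.toSpacetime →
      ∀ (m : ℕ) (S : Fin m → Literature.Geometry.Lorentzian.OutermostMOTS (𝓡 3) D'.h D'.k),
      (∀ j, ConnectedSpace (S j).surf) →
      (∀ j, IsCompact (((S j).exterior : Set X'))ᶜ ∧ (interior (((S j).exterior : Set X'))ᶜ).Nonempty) →
      Pairwise (fun j j' ↦ Disjoint (((S j).exterior : Set X'))ᶜ (((S j').exterior : Set X'))ᶜ) →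
      m ≤ N₀ := by
    intro X' _ _ _ _ D' 𝒟' h𝒟' m S hS hB hdisj
    obtain ⟨X'', _, _, _, _, _, _, _, _, D'', 𝒟'', _, -, hcomp, hmaxd, hvac, m', S'', hmm', hS'', hB'',
      hdisj'', hsob, hQ⟩ := hdom X' D' 𝒟' h𝒟' m S hS hB hdisj
    have hR : ∀ x, 0 ≤ D''.metric.scalarCurvature x :=
      Literature.Geometry.Lorentzian.InitialDataSet.IsVacuumConstraintSolution.scalarCurvature_nonneg_of_isMaximalData
        hvac hmaxd
    exact hmm'.trans (hN₀ X'' D'' hcomp hR m' S'' hS'' hB'' hdisj'' hsob hQ)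
  -- (3) per-count constants from the pointwise witnesses
  choose c Q hcQ using hW X D hD 𝒟 hmax
  -- (4) uniform constants: sums of positive parts over `m ≤ N₀`
  refine ⟨∑ n ∈ Finset.range (N₀ + 1), max (c n) 0, ∑ n ∈ Finset.range (N₀ + 1), max (Q n) 0, ?_⟩
  intro X' _ _ _ _ D' 𝒟' h𝒟' m S hS hB hdisj
  have hm : m ≤ N₀ := hbound X' D' 𝒟' h𝒟' m S hS hB hdisj
  have hmem : m ∈ Finset.range (N₀ + 1) := Finset.mem_range.mpr (Nat.lt_succ_of_le hm)
  have hc : c m ≤ ∑ n ∈ Finset.range (N₀ + 1), max (c n) 0 :=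
    (le_max_left _ _).trans
      (Finset.single_le_sum (f := fun n ↦ max (c n) 0) (fun n _ ↦ le_max_right _ _) hmem)
  have hQm : Q m ≤ ∑ n ∈ Finset.range (N₀ + 1), max (Q n) 0 :=
    (le_max_left _ _).trans
      (Finset.single_le_sum (f := fun n ↦ max (Q n) 0) (fun n _ ↦ le_max_right _ _) hmem)
  -- (5) the witness for `m`, with its cost relaxed to the uniform constants
  obtain ⟨X'', i₁, i₂, i₃, i₄, i₅, i₆, i₇, i₈, D'', 𝒟'', i₉, hsp, hcomp, S'', hS'', hB'', hdisj'', hsob, hQ''⟩ :=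
    hcQ m X' D' 𝒟' h𝒟' S hS hB hdisj
  refine ⟨X'', i₁, i₂, i₃, i₄, i₅, i₆, i₇, i₈, D'', 𝒟'', i₉, hsp, hcomp, S'', hS'', hB'', hdisj'',
    fun ζ hζ hζc ↦ (hsob ζ hζ hζc).trans ?_, hQ''.trans (ENNReal.ofReal_le_ofReal hQm)⟩
  exact mul_le_mul_left (ENNReal.ofReal_le_ofReal hc) _

/-- **Composition (skeleton theorem).** The crux `BoundedCensusGeometry` BY NAME and without hypotheses,
from the three stubs. [cite: IsenbergMazzeoPollack2002, Introduction p. 371] -/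
theorem BoundedCensusGeometry_of : BoundedCensusGeometry :=
  boundedCensusGeometry_of_statements stub_maximalLeafDominance stub_nonnegScalarCensusInequality
    stub_cheapWitnessPerCount

end Summit.FinalStateConjecture.FinalStateConjecture.Cruxes.BoundedCensusGeometry.MaximalLeafCensus

end
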